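import Literature.NumberTheory.DiophantineGeometry.GenEllThm21WithOne
import Literature.NumberTheory.DiophantineGeometry.GenEllCuspTransferMenu
import HarnessLib

/-!
# [GenEll] Thm 2.1 with a height coefficient: the limit `Λ → 1⁺` of the `With`-chain

S. Mochizuki, *Arithmetic elliptic curves in general position*, Math. J. Okayama Univ. **52** (2010),
Theorem 2.1, p. 11 [cite: MochizukiGenEll2010, Thm 2.1 p.11]: both (i) and (ii) are stated at the
coefficient `1 + ε` FOR EVERY `ε > 0`.  The `With`-predicates of `GenEllThm21With` (R-H round-2
exponent programme of the abc-iut cell, ruling R17) are literal reparametrisations of the record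
`ε`-predicates with a coefficient `Λ` multiplying the right-hand side (`1 + ε″ = Λ·(1+ε)`).  This file
records the elementary consequence of that quantifier structure which the programme's sentence of record
uses in words (EXP-SPEC §7: "drive `μ → 1`; then `Λ → 1⁺` and print's transfer applies as is") but which
was not yet a kernel sentence:

* §1 the `With`-predicates are MONOTONE in the coefficient (`Λ ≤ Λ′`: (ii)_Λ ⇒ (ii)_Λ′, (i)_Λ ⇒ (i)_Λ′);
* §2 the record predicates are EXACTLY the conjunctions over `Λ > 1` of their `With`-forms
  (`ABCCompactlyBounded S ↔ ∀ Λ > 1, ABCCompactlyBoundedWith S Λ`, `VojtaP1Deg d ↔ ∀ Λ > 1, VojtaP1DegWith d Λ`),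
  and the abc-type sentence with an exponent is right-continuous in the exponent
  (`ABCWithExponent Λ₀ ↔ ∀ Λ > Λ₀, ABCWithExponent Λ`, likewise on a set of points);
* §3 hence the printed transfer (ii) ⇒ (i), PROVED at `Λ = 1` (`GenEll_thm21_primes_holds`), applies to the
  LIMIT: statement (ii)_Λ at a finite set of primes for EVERY `Λ > 1` already gives (i)|_{ℙ¹} in every
  degree and the abc sentence (exponent `1 + ε` for every `ε`), with NO hypothesis of the shape
  `GenEll_thm21_primesWith Λ` — whereas at each FIXED `Λ > 1` that shape is not in print and not in
  reach of the printed noncritical-Belyi mechanism (exponent rigidity, `GenEllThm21With.belyi_slope_not_pos`,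
  memo `GenEllBelyiExponentRigidity`) and stays a predicate asserted by nobody;
* §4 the same limit read in the programme's `μ₀ = 1/Λ` currency: conclusions `ABCWithExponent (1/μ₀)` for
  every `μ₀ ∈ (0,1)` amount to `ABCWithExponent 1`; conclusions `ABCWithExponent (3/μ₀)` for every
  `μ₀ ∈ (0,1)` amount to `ABCWithExponent 3` (and not more by this route).

Everything here is bookkeeping of quantifiers over the tree's predicates (theorems only; no definitions,
no named facts; classical and elementary).  [GenEll] is refereed and outside the IUT dispute; nothing
here bears on [IUTchIII] Cor. 3.12, and nothing asserts abc (with or without exponent) or statement (ii)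
at any coefficient: every such sentence appears as a HYPOTHESIS or inside an `↔`.
-/

noncomputable section

namespace Literature.NumberTheory.DiophantineGeometry.GenEll

/-! ## §1 Monotonicity in the coefficient -/

/-- **`VojtaIneqWith` is monotone in the coefficient**: for `Λ ≤ Λ′` and `1 + ε ≥ 0`,
`ht ≲ Λ(1+ε)(log-diff + log-cond)` implies `ht ≲ Λ′(1+ε)(log-diff + log-cond)` (`log-diff + log-cond ≥ 0`;
`vojtaIneq_mono_eps` at the shifted `ε″`). [cite: MochizukiGenEll2010, Thm 2.1 p.11] -/
theorem vojtaIneqWith_mono_coeff {S : Set NFPoint} {d : ℕ} {Λ Λ' ε : ℝ} (hΛ : Λ ≤ Λ')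
    (hε : 0 ≤ 1 + ε) (h : VojtaIneqWith S d Λ ε) : VojtaIneqWith S d Λ' ε := by
  unfold VojtaIneqWith at h ⊢
  have hmul : Λ * (1 + ε) ≤ Λ' * (1 + ε) := mul_le_mul_of_nonneg_right hΛ hε
  exact vojtaIneq_mono_eps (by linarith) h

/-- **(ii)_Λ is monotone in `Λ`**: `ABCCompactlyBoundedWith S Λ → ABCCompactlyBoundedWith S Λ′` for `Λ ≤ Λ′`
(a larger coefficient is a weaker demand on every compactly bounded subset). [cite: MochizukiGenEll2010, Thm 2.1 (ii) p.11] -/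
theorem abcCompactlyBoundedWith_mono {S : Finset ℕ} {Λ Λ' : ℝ} (hΛ : Λ ≤ Λ')
    (h : ABCCompactlyBoundedWith S Λ) : ABCCompactlyBoundedWith S Λ' :=
  fun d hd ε hε D hD => vojtaIneqWith_mono_coeff hΛ (by linarith) (h d hd ε hε D hD)

/-- **(i)_Λ|_{ℙ¹} is monotone in `Λ`**: `VojtaP1DegWith d Λ → VojtaP1DegWith d Λ′` for `Λ ≤ Λ′`.
[cite: MochizukiGenEll2010, Thm 2.1 (i) p.11] -/
theorem vojtaP1DegWith_mono {d : ℕ} {Λ Λ' : ℝ} (hΛ : Λ ≤ Λ') (h : VojtaP1DegWith d Λ) :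
    VojtaP1DegWith d Λ' :=
  fun ε hε => vojtaIneqWith_mono_coeff hΛ (by linarith) (h ε hε)

/-! ## §2 The record predicates as conjunctions over `Λ > 1`; right-continuity in the exponent -/

/-- **Statement (ii) is the conjunction of the (ii)_Λ over `Λ > 1`**:
`ABCCompactlyBounded S ↔ ∀ Λ > 1, ABCCompactlyBoundedWith S Λ`.  (⇒) the `Λ = 1` regression and
monotonicity; (⇐) for `ε > 0` take `Λ := 1 + ε/2`: (ii)_Λ is the record inequality at every `ε″ > Λ − 1 = ε/2`
(`abcCompactlyBoundedWith_iff_shift`), in particular at `ε″ = ε`. [cite: MochizukiGenEll2010, Thm 2.1 (ii) p.11] -/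
theorem abcCompactlyBounded_iff_forall_gt_one (S : Finset ℕ) :
    ABCCompactlyBounded S ↔ ∀ Λ : ℝ, 1 < Λ → ABCCompactlyBoundedWith S Λ := by
  constructor
  · intro h Λ hΛ
    exact abcCompactlyBoundedWith_mono hΛ.le ((abcCompactlyBoundedWith_one_iff S).2 h)
  · intro h d hd ε hε D hD
    have hΛ : (1 : ℝ) < 1 + ε / 2 := by linarith
    exact (abcCompactlyBoundedWith_iff_shift (by linarith)).1 (h _ hΛ) d hd ε (by linarith) D hD

/-- **Statement (i)|_{ℙ¹} is the conjunction of the (i)_Λ over `Λ > 1`**: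
`VojtaP1Deg d ↔ ∀ Λ > 1, VojtaP1DegWith d Λ` (same proof, with `vojtaP1DegWith_iff_shift`).
[cite: MochizukiGenEll2010, Thm 2.1 (i) p.11] -/
theorem vojtaP1Deg_iff_forall_gt_one (d : ℕ) :
    VojtaP1Deg d ↔ ∀ Λ : ℝ, 1 < Λ → VojtaP1DegWith d Λ := by
  constructor
  · intro h Λ hΛ
    exact vojtaP1DegWith_mono hΛ.le ((vojtaP1DegWith_one_iff d).2 h)
  · intro h ε hε
    have hΛ : (1 : ℝ) < 1 + ε / 2 := by linarith
    exact (vojtaP1DegWith_iff_shift (by linarith)).1 (h _ hΛ) ε (by linarith)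

/-- **abc with an exponent is right-continuous in the exponent, on any set of points** (`Λ₀ > 0`):
`ABCWithExponentOn K Λ₀ ↔ ∀ Λ > Λ₀, ABCWithExponentOn K Λ`.  (⇐) for `ε > 0` use `Λ := Λ₀(1+ε)/(1+ε/2) > Λ₀`
at `ε/2`: the exponent `Λ·(1+ε/2)` IS `Λ₀·(1+ε)`. [cite: MochizukiGenEll2010, Thm 2.1 p.11] -/
theorem abcWithExponentOn_iff_forall_gt {K : Set NFPoint} {Λ₀ : ℝ} (hΛ₀ : 0 < Λ₀) :
    ABCWithExponentOn K Λ₀ ↔ ∀ Λ : ℝ, Λ₀ < Λ → ABCWithExponentOn K Λ := by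
  constructor
  · intro h Λ hΛ
    exact h.of_le hΛ.le
  · intro h ε hε
    have h2 : (0 : ℝ) < 1 + ε / 2 := by linarith
    have hΛ : Λ₀ < Λ₀ * (1 + ε) / (1 + ε / 2) := by
      rw [lt_div_iff₀ h2]
      nlinarith
    obtain ⟨C, hC, hK⟩ := h _ hΛ (ε / 2) (by linarith)
    refine ⟨C, hC, fun a b c ht hm => ?_⟩
    have hexp : Λ₀ * (1 + ε) / (1 + ε / 2) * (1 + ε / 2) = Λ₀ * (1 + ε) :=
      div_mul_cancel₀ _ h2.ne'
    have key := hK a b c ht hm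
    rwa [hexp] at key

/-- **abc with an exponent is right-continuous in the exponent** (`Λ₀ > 0`):
`ABCWithExponent Λ₀ ↔ ∀ Λ > Λ₀, ABCWithExponent Λ`.  In particular abc itself (`Λ₀ = 1`,
`abcWithExponent_one_iff`) is the conjunction over `Λ > 1` of the abc sentences with exponent `Λ`.
[cite: MochizukiGenEll2010, Thm 2.1 p.11] -/
theorem abcWithExponent_iff_forall_gt {Λ₀ : ℝ} (hΛ₀ : 0 < Λ₀) :
    ABCWithExponent Λ₀ ↔ ∀ Λ : ℝ, Λ₀ < Λ → ABCWithExponent Λ := by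
  rw [← abcWithExponentOn_univ_iff, abcWithExponentOn_iff_forall_gt hΛ₀]
  simp only [abcWithExponentOn_univ_iff]

/-! ## §3 The printed transfer applies to the limit `Λ → 1⁺` -/

/-- **(ii)_Λ for every `Λ > 1` ⟹ (i)|_{ℙ¹}**, for a finite set of PRIME numbers `S` and every degree `d > 0`:
the conjunction of the (ii)_Λ is statement (ii) itself (§2), to which the PROVED record transfer
`vojtaP1Deg_of_abcCompactlyBounded` ([GenEll] Thm 2.1 (ii) ⇒ (i), `GenEll_thm21_primes_holds`) applies.
No hypothesis of the shape `GenEll_thm21_primesWith Λ` occurs: the coefficient is carried through the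
STATEMENT's quantifier `∀ ε`, not through the proof's Belyi mechanism (which at each fixed `Λ > 1` does not
carry it — R19). [cite: MochizukiGenEll2010, Thm 2.1 pp.11–13] -/
theorem vojtaP1Deg_of_forall_gt_one_abcCompactlyBoundedWith {S : Finset ℕ} (hS : ∀ p ∈ S, p.Prime)
    (h : ∀ Λ : ℝ, 1 < Λ → ABCCompactlyBoundedWith S Λ) {d : ℕ} (hd : 0 < d) : VojtaP1Deg d :=
  vojtaP1Deg_of_abcCompactlyBounded hS ((abcCompactlyBounded_iff_forall_gt_one S).2 h) hd

/-- **[GenEll] Thm 2.1 for `ℙ¹` in the limit currency, (i) ⟺ (ii)**: for a finite set of primes `S`,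
`(∀ Λ > 1, ABCCompactlyBoundedWith S Λ) ↔ (∀ d > 0, VojtaP1Deg d)` (`vojtaP1Deg_iff_abcCompactlyBounded`
through §2). [cite: MochizukiGenEll2010, Thm 2.1 p.11] -/
theorem forall_gt_one_abcCompactlyBoundedWith_iff_vojtaP1Deg {S : Finset ℕ} (hS : ∀ p ∈ S, p.Prime) :
    (∀ Λ : ℝ, 1 < Λ → ABCCompactlyBoundedWith S Λ) ↔ ∀ d : ℕ, 0 < d → VojtaP1Deg d := by
  rw [← abcCompactlyBounded_iff_forall_gt_one]
  exact (vojtaP1Deg_iff_abcCompactlyBounded hS).symm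

/-- **(ii)_Λ for every `Λ > 1` ⟹ (i)_{Λ′}|_{ℙ¹} for every `Λ′ ≥ 1`** (the `With`-form of the conclusion, by
monotonicity from `Λ′ = 1`). [cite: MochizukiGenEll2010, Thm 2.1 pp.11–13] -/
theorem vojtaP1DegWith_of_forall_gt_one_abcCompactlyBoundedWith {S : Finset ℕ} (hS : ∀ p ∈ S, p.Prime)
    (h : ∀ Λ : ℝ, 1 < Λ → ABCCompactlyBoundedWith S Λ) {d : ℕ} (hd : 0 < d) {Λ' : ℝ} (hΛ' : 1 ≤ Λ') :
    VojtaP1DegWith d Λ' :=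
  vojtaP1DegWith_mono hΛ'
    ((vojtaP1DegWith_one_iff d).2 (vojtaP1Deg_of_forall_gt_one_abcCompactlyBoundedWith hS h hd))

/-- **(ii)_Λ for every `Λ > 1` ⟹ abc with exponent `1`** (`= abc`, `abcWithExponent_one_iff`), for a finite
set of primes `S` — the kernel form of "drive the coefficient to `1⁺` and print's transfer applies as is":
unconditional in [GenEll], no `GenEll_thm21_primesWith Λ` binder. [cite: MochizukiGenEll2010, Thm 2.1 pp.11–13] -/
theorem abcWithExponent_one_of_forall_gt_one_abcCompactlyBoundedWith {S : Finset ℕ}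
    (hS : ∀ p ∈ S, p.Prime) (h : ∀ Λ : ℝ, 1 < Λ → ABCCompactlyBoundedWith S Λ) : ABCWithExponent 1 :=
  abcWithExponent_one_of_abcCompactlyBounded_primes hS ((abcCompactlyBounded_iff_forall_gt_one S).2 h)

/-- The same with the displayed abc sentence as conclusion:
`∀ ε > 0, ∃ C > 0, ∀ abc triples (a, b, c), c < C·rad(abc)^{1+ε}`. [cite: MochizukiGenEll2010, Thm 2.1 pp.11–13] -/
theorem abc_of_forall_gt_one_abcCompactlyBoundedWith {S : Finset ℕ} (hS : ∀ p ∈ S, p.Prime)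
    (h : ∀ Λ : ℝ, 1 < Λ → ABCCompactlyBoundedWith S Λ) :
    ∀ ε : ℝ, 0 < ε → ∃ C : ℝ, 0 < C ∧
      ∀ a b c : ℕ, IsABCTriple a b c → (c : ℝ) < C * ((rad a b c : ℕ) : ℝ) ^ (1 + ε) :=
  abc_of_abcCompactlyBounded_of_primes hS ((abcCompactlyBounded_iff_forall_gt_one S).2 h)

/-! ## §4 The limit in the `μ₀ = 1/Λ` currency of the exponent programme -/

/-- **Exponent `1/μ₀` at every `μ₀ ∈ (0,1)` amounts to exponent `1`**: if `ABCWithExponent (1/μ₀)` for every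
`0 < μ₀ < 1`, then `ABCWithExponent 1` (§2 right-continuity at `Λ₀ = 1`, with `Λ = 1/μ₀` running through
all of `(1, ∞)`). [cite: MochizukiGenEll2010, Thm 2.1 p.11] -/
theorem abcWithExponent_one_of_forall_mu
    (h : ∀ μ₀ : ℝ, 0 < μ₀ → μ₀ < 1 → ABCWithExponent (1 / μ₀)) : ABCWithExponent 1 := by
  refine (abcWithExponent_iff_forall_gt one_pos).2 fun Λ hΛ => ?_
  have hΛ0 : 0 < Λ := by linarith
  have key := h (1 / Λ) (by positivity) (by rw [div_lt_one hΛ0]; exact hΛ)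
  rwa [one_div_one_div] at key

/-- **Exponent `3/μ₀` at every `μ₀ ∈ (0,1)` amounts to exponent `3`** (and this route gives no less): if
`ABCWithExponent (3/μ₀)` for every `0 < μ₀ < 1`, then `ABCWithExponent 3` (§2 right-continuity at `Λ₀ = 3`,
`Λ = 3/μ₀` running through `(3, ∞)`). [cite: MochizukiGenEll2010, Thm 2.1 p.11] -/
theorem abcWithExponent_three_of_forall_mu
    (h : ∀ μ₀ : ℝ, 0 < μ₀ → μ₀ < 1 → ABCWithExponent (3 / μ₀)) : ABCWithExponent 3 := by
  refine (abcWithExponent_iff_forall_gt (by norm_num : (0 : ℝ) < 3)).2 fun Λ hΛ => ?_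
  have hΛ0 : 0 < Λ := by linarith
  have hμ : 3 / Λ < 1 := by rw [div_lt_one hΛ0]; exact hΛ
  have key := h (3 / Λ) (by positivity) hμ
  have h3 : (3 : ℝ) / (3 / Λ) = Λ := by
    field_simp
  rwa [h3] at key

/-- **(ii)_{1/μ₀} at every `μ₀ ∈ (0,1)` ⟹ abc with exponent `1`**, for a finite set of primes `S`: the (ii)-side
door of the programme in the limit `μ₀ → 1⁻` — by §3, with `Λ = 1/μ₀` running through `(1, ∞)`; no
`GenEll_thm21_primesWith` binder. [cite: MochizukiGenEll2010, Thm 2.1 pp.11–13] -/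
theorem abcWithExponent_one_of_forall_mu_abcCompactlyBoundedWith {S : Finset ℕ} (hS : ∀ p ∈ S, p.Prime)
    (h : ∀ μ₀ : ℝ, 0 < μ₀ → μ₀ < 1 → ABCCompactlyBoundedWith S (1 / μ₀)) : ABCWithExponent 1 := by
  refine abcWithExponent_one_of_forall_gt_one_abcCompactlyBoundedWith hS fun Λ hΛ => ?_
  have hΛ0 : 0 < Λ := by linarith
  have key := h (1 / Λ) (by positivity) (by rw [div_lt_one hΛ0]; exact hΛ)
  rwa [one_div_one_div] at key

end Literature.NumberTheory.DiophantineGeometry.GenEll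

end
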